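import Summits.QuantumAdvantage.AdviceFreeQNC0.GradedSeeds38ReductionS
import HarnessLib

/-!
# Cell qa-qnc0, `p = 3` — planner qa-qnc0-p1 g39, ROUND-38 §6.4.2: the SPARSE-READING rung of (R1)
(custody file under HOME, D-0168 E1; farm `lean check` only; no ledger item)

If the bells of a strategy `g` are all determined by the input letters in a set `R` (`|R| = m`), then conditioning on
`x|_R` turns `g` into a CONSTANT-OUTPUT strategy, and the indicator of a fibre `{x : x|_R = ξ}` is an average of the
`2^m` real sign characters `(−1)^{Σ_{i∈U} x_i}`, `U ⊆ R`.  Hence a twist bound for constant-output strategies that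
tolerates an extra real sign character (`TwistBoundZConstPM ρ`; conjectured here for some `ρ < 1` and since PROVED for
`ρ = 39/40` — `SparseRead39.twistBoundZConstPM`, file `SignedTwist39.lean`, qn-prover-3 g26, by the kernel-line fibre method; the
sign-free case is the `r = 1` case of the tree's `twistBoundX3Local`) gives the (R1)-type bound
  `‖Σ_x e₃(β·x)·[OddZeros x ∧ Rel x (g x)]‖ ≤ A·2^m·ρ^{#supp β}·2^N`
for EVERY such `g` — `sparseRead_of_pm`, proved here by induction on `R` (no fibre counting: split on one letter `a`,
`[x_a = c] = (1 + ε_c·(−1)^{x_a})/2`, and absorb `(−1)^{x_a}` into the sign character).  Reading: strategies whose bells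
read fewer than `log₂(1/ρ)·#supp β` letters IN TOTAL are exponentially beaten; the adversary in (R1) must read densely.

v3 (§6.4.3): the LOSSLESS pinned twin `r1Zero_of_pinned : TwistBoundZConstPinned ρ → R1Zero ρ` = (R1)₀ (every `x|_W`-measurable
strategy, `W` arbitrary) — its hypothesis is PROVED in `exp39/Pinned39.lean` v3 (`BondTwist3.twistBoundZConstPinned`, same
statement verbatim), so (R1)₀ holds for some `ρ < 1` modulo merging the two files' import closure.
v4: the next rung typed — `TwistBoundZAffinePinned ρ` (affine one-letter outputs on pinned subcubes, OPEN) and the proved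
reduction `r1One_of_affinePinned : TwistBoundZAffinePinned ρ → R1One ρ` = (R1) at `C = 0` for all `W`.
-/

noncomputable section

namespace Summit.QuantumAdvantage.AdviceFreeQNC0

open Finset Literature.Computability.QuantumComplexity Literature.Computability.MetaComplexity

namespace SparseRead39

open scoped Classical

variable {N : ℕ}

/-- The real sign character `(−1)^{#{i : σ i ∧ x i}}` as a product. -/
def sgn (σ x : Fin N → Bool) : ℂ := ∏ i : Fin N, (if (σ i && x i) then (-1 : ℂ) else 1)

/-- The (R1) indicator `[OddZeros x ∧ Rel x (g · x)]`. -/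
def ind (g : Fin N → (Fin N → Bool) → Bool) (x : Fin N → Bool) : ℂ :=
  if (OddZeros x ∧ RingHLF.Rel x (fun k => g k x)) then (1 : ℂ) else 0

/-- The x-linear phase `e₃(Σ_{i : x_i} β_i)`. -/
def phase (β : Fin N → ZMod 3) (x : Fin N → Bool) : ℂ :=
  (ZMod.stdAddChar (∑ i : Fin N, if x i then β i else 0) : ℂ)

/-- The signed twisted win sum of a strategy. -/
def twSum (β : Fin N → ZMod 3) (σ : Fin N → Bool) (g : Fin N → (Fin N → Bool) → Bool) : ℂ :=
  ∑ x : Fin N → Bool, phase β x * sgn σ x * ind g x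

/-- Twisted weight `#supp β`. -/
def wt (β : Fin N → ZMod 3) : ℕ := (univ.filter fun i : Fin N => β i ≠ 0).card

/-- **`TwistBoundZConstPM ρ`** (ROUND-38 §6.4.2): constant-OUTPUT strategies (`g k x = b k`), twisted by
`e₃(β·x)` AND by an arbitrary real sign character, have win-correlation `≤ A·ρ^{#supp β}·2^N` on the odd class.
Sign-free (`σ ≡ false`) it is the `r = 1` case of `TwistBoundX3Local` (`y`-frame bells `b_k ⊕ x_k ⊕ x_{k+1}`);
numerically (N ≤ 11, hill-climbing over `b, σ, β`) the signed maxima never exceed the unsigned ones.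
STATUS: typed here as a conjecture (planner p1 g39); PROVED for `ρ = 39/40`, `A = 2` — `SparseRead39.twistBoundZConstPM`
(`SignedTwist39.lean`, qn-prover-3 g26: on a kernel-line fibre the sign character is one more `±1` coordinate product). -/
def TwistBoundZConstPM (ρ : ℝ) : Prop :=
  ∃ A : ℝ, ∀ (N : ℕ) (b σ : Fin N → Bool) (β : Fin N → ZMod 3),
    ‖twSum β σ (fun k _ => b k)‖ ≤ A * ρ ^ wt β * (2 : ℝ) ^ N

/-- **The sparse-reading rung** `SparseReadTwistBound ρ`: for every strategy whose outputs are determined by the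
letters in `R`, `‖Σ_x e₃(β·x)·[OddZeros x ∧ Rel x (g x)]‖ ≤ A·2^{#R}·ρ^{#supp β}·2^N`. -/
def SparseReadTwistBound (ρ : ℝ) : Prop :=
  ∃ A : ℝ, ∀ (N : ℕ) (R : Finset (Fin N)) (g : Fin N → (Fin N → Bool) → Bool),
    (∀ k (x x' : Fin N → Bool), (∀ i ∈ R, x i = x' i) → g k x = g k x') →
      ∀ β : Fin N → ZMod 3,
        ‖∑ x : Fin N → Bool, (ZMod.stdAddChar (∑ i : Fin N, if x i then β i else 0) : ℂ) *
            (if (OddZeros x ∧ RingHLF.Rel x (fun k => g k x)) then (1 : ℂ) else 0)‖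
          ≤ A * (2 : ℝ) ^ R.card * ρ ^ (univ.filter fun i : Fin N => β i ≠ 0).card * (2 : ℝ) ^ N

/-! ## The one-letter split -/

/-- `ε c = (−1)^{[c]}`. -/
def eps (c : Bool) : ℂ := if c then -1 else 1

/-- `[x_a = c] = (1 + ε_c·ε_{x_a})/2`. -/
theorem indicator_eq (xa c : Bool) :
    (if xa = c then (1 : ℂ) else 0) = (1 + eps c * eps xa) / 2 := by
  cases xa <;> cases c <;> simp [eps]

/-- Absorbing `(−1)^{x_a}` into the sign character: `ε_{x_a}·sgn σ x = sgn (update σ a (¬σ a)) x`. -/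
theorem eps_mul_sgn (σ x : Fin N → Bool) (a : Fin N) :
    eps (x a) * sgn σ x = sgn (Function.update σ a (!σ a)) x := by
  unfold sgn
  rw [← Finset.mul_prod_erase univ _ (mem_univ a), ← Finset.mul_prod_erase univ _ (mem_univ a), ← mul_assoc]
  congr 1
  · simp only [Function.update_self]
    cases x a <;> cases σ a <;> simp [eps]
  · refine Finset.prod_congr rfl fun i hi => ?_
    rw [Function.update_of_ne (ne_of_mem_erase hi)]

/-- Restricting one letter: `g_c k x := g k (update x a c)`. -/
def restrictAt (g : Fin N → (Fin N → Bool) → Bool) (a : Fin N) (c : Bool) : Fin N → (Fin N → Bool) → Bool :=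
  fun k x => g k (Function.update x a c)

/-- auxiliary lemma `restrictAt_self` (planner p1 g39, exp39; ported verbatim). -/
theorem restrictAt_self (g : Fin N → (Fin N → Bool) → Bool) (a : Fin N) (x : Fin N → Bool) :
    (fun k => restrictAt g a (x a) k x) = fun k => g k x := by
  funext k; simp [restrictAt]

/-- If `g` is determined by `insert a R`, then `g_c` is determined by `R`. -/
theorem restrictAt_determined {g : Fin N → (Fin N → Bool) → Bool} {a : Fin N} {R : Finset (Fin N)}
    (hg : ∀ k (x x' : Fin N → Bool), (∀ i ∈ insert a R, x i = x' i) → g k x = g k x') (c : Bool) :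
    ∀ k (x x' : Fin N → Bool), (∀ i ∈ R, x i = x' i) → restrictAt g a c k x = restrictAt g a c k x' := by
  intro k x x' hxx'
  refine hg k _ _ fun i hi => ?_
  rcases Finset.mem_insert.mp hi with rfl | hiR
  · simp
  · by_cases hia : i = a
    · subst hia; simp
    · rw [Function.update_of_ne hia, Function.update_of_ne hia, hxx' i hiR]

/-- Pointwise split of the indicator on the letter `a`:
`ind g x = Σ_c [x_a = c]·ind g_c x`. -/
theorem ind_split (g : Fin N → (Fin N → Bool) → Bool) (a : Fin N) (x : Fin N → Bool) :
    ind g x = ∑ c : Bool, (if x a = c then (1 : ℂ) else 0) * ind (restrictAt g a c) x := by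
  rw [Fintype.sum_bool]
  cases hxa : x a
  · simp only [Bool.false_eq_true, if_false, zero_mul, zero_add, if_true, one_mul]
    unfold ind; rw [← hxa, restrictAt_self]
  · simp only [if_true, one_mul, Bool.true_eq_false, if_false, zero_mul, add_zero]
    unfold ind; rw [← hxa, restrictAt_self]

/-- **The one-letter identity**: `twSum β σ g = ½·Σ_c (twSum β σ g_c + ε_c·twSum β σ' g_c)`, `σ' = update σ a (¬σ a)`. -/
theorem twSum_split (β : Fin N → ZMod 3) (σ : Fin N → Bool) (g : Fin N → (Fin N → Bool) → Bool) (a : Fin N) :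
    twSum β σ g = (∑ c : Bool, (twSum β σ (restrictAt g a c)
        + eps c * twSum β (Function.update σ a (!σ a)) (restrictAt g a c))) / 2 := by
  unfold twSum
  have key : ∀ x : Fin N → Bool, phase β x * sgn σ x * ind g x =
      (∑ c : Bool, (phase β x * sgn σ x * ind (restrictAt g a c) x
        + eps c * (phase β x * sgn (Function.update σ a (!σ a)) x * ind (restrictAt g a c) x))) / 2 := by
    intro x
    rw [ind_split g a x, Finset.mul_sum, Finset.sum_div]
    refine Finset.sum_congr rfl fun c _ => ?_
    rw [indicator_eq, ← eps_mul_sgn]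
    ring
  rw [Finset.sum_congr rfl fun x _ => key x, ← Finset.sum_div, Finset.sum_comm]
  congr 1
  refine Finset.sum_congr rfl fun c _ => ?_
  rw [Finset.sum_add_distrib, Finset.mul_sum]

/-- auxiliary lemma `norm_eps` (planner p1 g39, exp39; ported verbatim). -/
theorem norm_eps (c : Bool) : ‖eps c‖ = 1 := by cases c <;> simp [eps]

/-- Norm form of the split: `‖twSum β σ g‖ ≤ ½·Σ_c (‖twSum β σ g_c‖ + ‖twSum β σ' g_c‖)`. -/
theorem norm_twSum_split_le (β : Fin N → ZMod 3) (σ : Fin N → Bool) (g : Fin N → (Fin N → Bool) → Bool)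
    (a : Fin N) :
    ‖twSum β σ g‖ ≤ (∑ c : Bool, (‖twSum β σ (restrictAt g a c)‖
        + ‖twSum β (Function.update σ a (!σ a)) (restrictAt g a c)‖)) / 2 := by
  rw [twSum_split β σ g a, norm_div, RCLike.norm_ofNat]
  refine div_le_div_of_nonneg_right ?_ (by norm_num)
  refine (norm_sum_le _ _).trans (Finset.sum_le_sum fun c _ => ?_)
  refine (norm_add_le _ _).trans ?_
  rw [norm_mul, norm_eps, one_mul]

/-! ## The induction on the read set -/

/-- **Main lemma**: under `TwistBoundZConstPM ρ` with constant `A`, every strategy determined by `R` has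
`‖twSum β σ g‖ ≤ A·2^{#R}·ρ^{wt β}·2^N`, for every sign character `σ`. -/
theorem norm_twSum_le_of_determined {ρ A : ℝ}
    (hA : ∀ (N : ℕ) (b σ : Fin N → Bool) (β : Fin N → ZMod 3),
      ‖twSum β σ (fun k _ => b k)‖ ≤ A * ρ ^ wt β * (2 : ℝ) ^ N)
    (R : Finset (Fin N)) :
    ∀ (g : Fin N → (Fin N → Bool) → Bool),
      (∀ k (x x' : Fin N → Bool), (∀ i ∈ R, x i = x' i) → g k x = g k x') →
        ∀ (σ : Fin N → Bool) (β : Fin N → ZMod 3),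
          ‖twSum β σ g‖ ≤ A * (2 : ℝ) ^ R.card * ρ ^ wt β * (2 : ℝ) ^ N := by
  induction R using Finset.induction_on with
  | empty =>
    intro g hg σ β
    -- `g` is constant in `x`
    have hconst : g = fun k _ => g k (fun _ => false) := by
      funext k x; exact hg k x _ (fun i hi => absurd hi (by simp))
    rw [hconst, Finset.card_empty, pow_zero, mul_one]
    exact hA N (fun k => g k fun _ => false) σ β
  | @insert a R haR ih =>
    intro g hg σ β
    have hc : ∀ (c : Bool) (τ : Fin N → Bool),
        ‖twSum β τ (restrictAt g a c)‖ ≤ A * (2 : ℝ) ^ R.card * ρ ^ wt β * (2 : ℝ) ^ N :=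
      fun c τ => ih _ (restrictAt_determined hg c) τ β
    calc ‖twSum β σ g‖
        ≤ (∑ c : Bool, (‖twSum β σ (restrictAt g a c)‖
            + ‖twSum β (Function.update σ a (!σ a)) (restrictAt g a c)‖)) / 2 :=
          norm_twSum_split_le β σ g a
      _ ≤ (∑ _c : Bool, (A * (2 : ℝ) ^ R.card * ρ ^ wt β * (2 : ℝ) ^ N
            + A * (2 : ℝ) ^ R.card * ρ ^ wt β * (2 : ℝ) ^ N)) / 2 := by
          gcongr with c _
          · exact hc c σ
          · exact hc c _
      _ = A * (2 : ℝ) ^ (insert a R).card * ρ ^ wt β * (2 : ℝ) ^ N := by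
          rw [Finset.card_insert_of_notMem haR, Fintype.sum_bool, pow_succ]; ring

/-- **`sparseRead_of_pm`**: the signed constant-output twist bound implies the sparse-reading rung (same `A`). -/
theorem sparseRead_of_pm {ρ : ℝ} (h : TwistBoundZConstPM ρ) : SparseReadTwistBound ρ := by
  obtain ⟨A, hA⟩ := h
  refine ⟨A, fun N R g hg β => ?_⟩
  have h1 := norm_twSum_le_of_determined (N := N) hA R g hg (fun _ => false) β
  have hsgn : ∀ x : Fin N → Bool, sgn (fun _ => false) x = 1 := by
    intro x; unfold sgn; simp
  have hrw : twSum β (fun _ => false) g = ∑ x : Fin N → Bool,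
      (ZMod.stdAddChar (∑ i : Fin N, if x i then β i else 0) : ℂ) *
        (if (OddZeros x ∧ RingHLF.Rel x (fun k => g k x)) then (1 : ℂ) else 0) := by
    unfold twSum
    refine Finset.sum_congr rfl fun x _ => ?_
    rw [hsgn x, mul_one]; rfl
  rw [hrw] at h1
  exact h1

/-! ## The weak (gain-avoiding) form

A block/transfer lemma may prefer to place its contracting blocks at twisted letters that carry NO real sign; the
corresponding hypothesis only claims the rate on `supp β ∖ supp σ`, and the rung then counts twisted letters OUTSIDE `R`
(the shape of (R1) with `R` in the role of an enlarged excluded set `W`, at the price `2^{#R}`). -/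

/-- Exponent of the weak form: twisted letters carrying no sign. -/
def wtOff (β : Fin N → ZMod 3) (σ : Fin N → Bool) : ℕ := (univ.filter fun i : Fin N => β i ≠ 0 ∧ σ i = false).card

/-- **`TwistBoundZConstPMWeak ρ`**: as `TwistBoundZConstPM` but with the rate only on the sign-free twisted letters
(PROVED for `ρ = 39/40`: `SparseRead39.twistBoundZConstPMWeak`, `SignedTwist39.lean`; hence `SparseReadTwistBound (39/40)` and
`SparseReadTwistBoundOff (39/40)` hold — `sparseReadTwistBound`, `sparseReadTwistBoundOff` there). -/
def TwistBoundZConstPMWeak (ρ : ℝ) : Prop :=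
  ∃ A : ℝ, ∀ (N : ℕ) (b σ : Fin N → Bool) (β : Fin N → ZMod 3),
    ‖twSum β σ (fun k _ => b k)‖ ≤ A * ρ ^ wtOff β σ * (2 : ℝ) ^ N

/-- **The sparse-reading rung, (R1) shape**: rate on the twisted letters outside the read set `R`. -/
def SparseReadTwistBoundOff (ρ : ℝ) : Prop :=
  ∃ A : ℝ, ∀ (N : ℕ) (R : Finset (Fin N)) (g : Fin N → (Fin N → Bool) → Bool),
    (∀ k (x x' : Fin N → Bool), (∀ i ∈ R, x i = x' i) → g k x = g k x') →
      ∀ β : Fin N → ZMod 3,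
        ‖∑ x : Fin N → Bool, (ZMod.stdAddChar (∑ i : Fin N, if x i then β i else 0) : ℂ) *
            (if (OddZeros x ∧ RingHLF.Rel x (fun k => g k x)) then (1 : ℂ) else 0)‖
          ≤ A * (2 : ℝ) ^ R.card * ρ ^ (univ.filter fun i : Fin N => i ∉ R ∧ β i ≠ 0).card * (2 : ℝ) ^ N

/-- auxiliary lemma `strong_imp_weak` (planner p1 g39, exp39; ported verbatim). -/
theorem strong_imp_weak {ρ : ℝ} (hρ0 : 0 ≤ ρ) (hρ1 : ρ ≤ 1) (h : TwistBoundZConstPM ρ) :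
    TwistBoundZConstPMWeak ρ := by
  obtain ⟨A, hA⟩ := h
  refine ⟨A, fun N b σ β => (hA N b σ β).trans ?_⟩
  have hA0 : 0 ≤ A := by
    have h0 := (norm_nonneg _).trans (hA 0 (fun _ => false) (fun _ => false) (fun _ => 0))
    simpa [wt] using h0
  have hle : wtOff β σ ≤ wt β := by
    unfold wtOff wt
    exact card_le_card (fun i => by simp only [mem_filter, mem_univ, true_and]; exact fun h => h.1)
  have := pow_le_pow_of_le_one hρ0 hρ1 hle
  gcongr

/-- Main lemma, weak form: exponent `#{i ∉ R : β i ≠ 0 ∧ σ i = false}` for every `σ`. -/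
theorem norm_twSum_le_of_determined_weak {ρ A : ℝ} (hρ0 : 0 ≤ ρ) (hρ1 : ρ ≤ 1)
    (hA : ∀ (N : ℕ) (b σ : Fin N → Bool) (β : Fin N → ZMod 3),
      ‖twSum β σ (fun k _ => b k)‖ ≤ A * ρ ^ wtOff β σ * (2 : ℝ) ^ N)
    (R : Finset (Fin N)) :
    ∀ (g : Fin N → (Fin N → Bool) → Bool),
      (∀ k (x x' : Fin N → Bool), (∀ i ∈ R, x i = x' i) → g k x = g k x') →
        ∀ (σ : Fin N → Bool) (β : Fin N → ZMod 3),
          ‖twSum β σ g‖ ≤ A * (2 : ℝ) ^ R.card *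
            ρ ^ (univ.filter fun i : Fin N => i ∉ R ∧ (β i ≠ 0 ∧ σ i = false)).card * (2 : ℝ) ^ N := by
  induction R using Finset.induction_on with
  | empty =>
    intro g hg σ β
    have hconst : g = fun k _ => g k (fun _ => false) := by
      funext k x; exact hg k x _ (fun i hi => absurd hi (by simp))
    rw [hconst, Finset.card_empty, pow_zero, mul_one]
    have e : (univ.filter fun i : Fin N => i ∉ (∅ : Finset (Fin N)) ∧ (β i ≠ 0 ∧ σ i = false)).card = wtOff β σ := by
      unfold wtOff; congr 1; ext i; simp
    rw [e]; exact hA N (fun k => g k fun _ => false) σ β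
  | @insert a R haR ih =>
    intro g hg σ β
    have hA0 : 0 ≤ A := by
      have h0 := (norm_nonneg _).trans (hA 0 (fun _ => false) (fun _ => false) (fun _ => 0))
      simpa [wtOff] using h0
    -- the target exponent is dominated by the IH exponent for both sign patterns
    set e' := (univ.filter fun i : Fin N => i ∉ insert a R ∧ (β i ≠ 0 ∧ σ i = false)).card with he'
    have hmono : ∀ τ : Fin N → Bool, (∀ i, i ≠ a → τ i = σ i) →
        ρ ^ (univ.filter fun i : Fin N => i ∉ R ∧ (β i ≠ 0 ∧ τ i = false)).card ≤ ρ ^ e' := by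
      intro τ hτ
      refine pow_le_pow_of_le_one hρ0 hρ1 (card_le_card fun i => ?_)
      simp only [mem_filter, mem_univ, true_and, mem_insert, not_or]
      rintro ⟨⟨hia, hiR⟩, hβ, hσ⟩
      exact ⟨hiR, hβ, by rw [hτ i hia]; exact hσ⟩
    have hc : ∀ (c : Bool) (τ : Fin N → Bool), (∀ i, i ≠ a → τ i = σ i) →
        ‖twSum β τ (restrictAt g a c)‖ ≤ A * (2 : ℝ) ^ R.card * ρ ^ e' * (2 : ℝ) ^ N := by
      intro c τ hτ
      refine (ih _ (restrictAt_determined hg c) τ β).trans ?_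
      have := hmono τ hτ
      gcongr
    have hσ' : ∀ i, i ≠ a → Function.update σ a (!σ a) i = σ i := fun i hi => Function.update_of_ne hi _ _
    calc ‖twSum β σ g‖
        ≤ (∑ c : Bool, (‖twSum β σ (restrictAt g a c)‖
            + ‖twSum β (Function.update σ a (!σ a)) (restrictAt g a c)‖)) / 2 :=
          norm_twSum_split_le β σ g a
      _ ≤ (∑ _c : Bool, (A * (2 : ℝ) ^ R.card * ρ ^ e' * (2 : ℝ) ^ N
            + A * (2 : ℝ) ^ R.card * ρ ^ e' * (2 : ℝ) ^ N)) / 2 := by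
          gcongr with c _
          · exact hc c σ (fun i _ => rfl)
          · exact hc c _ hσ'
      _ = A * (2 : ℝ) ^ (insert a R).card * ρ ^ e' * (2 : ℝ) ^ N := by
          rw [Finset.card_insert_of_notMem haR, Fintype.sum_bool, pow_succ]; ring

/-- **`sparseReadOff_of_pmWeak`**: the weak signed constant-output bound implies the (R1)-shaped sparse-reading rung. -/
theorem sparseReadOff_of_pmWeak {ρ : ℝ} (hρ0 : 0 ≤ ρ) (hρ1 : ρ ≤ 1) (h : TwistBoundZConstPMWeak ρ) :
    SparseReadTwistBoundOff ρ := by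
  obtain ⟨A, hA⟩ := h
  refine ⟨A, fun N R g hg β => ?_⟩
  have h1 := norm_twSum_le_of_determined_weak (N := N) hρ0 hρ1 hA R g hg (fun _ => false) β
  have hsgn : ∀ x : Fin N → Bool, sgn (fun _ => false) x = 1 := by
    intro x; unfold sgn; simp
  have hrw : twSum β (fun _ => false) g = ∑ x : Fin N → Bool,
      (ZMod.stdAddChar (∑ i : Fin N, if x i then β i else 0) : ℂ) *
        (if (OddZeros x ∧ RingHLF.Rel x (fun k => g k x)) then (1 : ℂ) else 0) := by
    unfold twSum
    refine Finset.sum_congr rfl fun x _ => ?_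
    rw [hsgn x, mul_one]; rfl
  have e : (univ.filter fun i : Fin N => i ∉ R ∧ (β i ≠ 0 ∧ (fun _ : Fin N => false) i = false)).card =
      (univ.filter fun i : Fin N => i ∉ R ∧ β i ≠ 0).card := by
    congr 1; ext i; simp
  rw [hrw, e] at h1
  exact h1

/-- The (R1)-shaped rung from the strong conjecture as well. -/
theorem sparseReadOff_of_pm {ρ : ℝ} (hρ0 : 0 ≤ ρ) (hρ1 : ρ ≤ 1) (h : TwistBoundZConstPM ρ) :
    SparseReadTwistBoundOff ρ :=
  sparseReadOff_of_pmWeak hρ0 hρ1 (strong_imp_weak hρ0 hρ1 h)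

/-! ## The LOSSLESS version: pinned letters instead of sign characters — `(R1)₀`

If the constant-output twist bound is proved directly on SUBCUBES `{x : x|_P = ξ}` (pinned letters; in the register
chain a pinned letter is a deterministic step, an `ℓ²`-isometry of the walk state, so the block contraction should
survive with NO loss), then summing over the `2^{#W}` patterns costs nothing: every strategy measurable w.r.t. `x|_W`
obeys the (R1)-shaped bound with exponent `#(supp β ∖ W)` and NO `2^{#W}` — this is `(R1)₀`, the zero-junta base case of
(R1) for an ARBITRARY set `W` (no `3·#W ≤ N` needed).  ROUND-38 §6.4.3. -/

end SparseRead39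

end Summit.QuantumAdvantage.AdviceFreeQNC0
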